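import Summits.AnomalousDissipation.AnomalousDissipation.Theorems.SawtoothPulseCascadeK1LocalisedCascadeCutoffBoundSeq
import Summits.AnomalousDissipation.AnomalousDissipation.Theorems.SawtoothPulseCascadeK1LocalisedCascadeResidualShear
import Summits.AnomalousDissipation.AnomalousDissipation.Theorems.SawtoothPulseCascadeK1LocalisedCascadeZoneJunk

/-!
# K1loc, line `Spectral` / SeqCone — helper: THE CUT-OFF SOCKET OF THE H HALF-STEP (S-B constants, profile side)

Helper file of the prover lane on the crux `K1LocalisedCascade` (stmt-AnomalousDissipation-19491), route
`SawtoothPulseCascade` (glue seat k1loc-p3; Stage 3 of the concrete instantiation of `…K1Ledger.cascade_ledger_step_H′`).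
The profile-side hypotheses of the sharp capstone are served by the strip cut-offs `X^± = sT((±U_j′ − (1−2ε))/ε)`, the wider
cut-offs `X̃^± ` at width `2ε` (so that `X^±·X̃^± = X^±`, `hXXs`), the exact-flat profile `Ũ_j` at threshold `3ε` and the
residual `Q_res = −γ(U_j − Ũ_j)·`: this file proves the remaining glue — flatness on the support of `X̃^±` and of its derivative
with `ε₁ = 2·(2ε)` (`hflat`), the product identity (`hXXs`), ONE bound sequence `D` for both families (`hDp/hDm`), the residual
slope/curvature bounds in `γ`-form (for the twist moments), the monotonicity of the twist-moment bound in `|n|` (`hAQn`), and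
the transfer of the 1-D corner-zone measure `4Mδ_j/π` (`…ZoneJunk`) to the two torus zone volumes of the capstone.
No definitions; no statement about the stub.  [cite: ElgindiLissMattingly2025, §1.2.2] [problem: turb]
-/

-- `Summit.<Summit>.<Problem>`: single-conjunct summit, the duplicate namespace segment is deliberate.
set_option linter.dupNamespace false

noncomputable section

namespace Summit.AnomalousDissipation.AnomalousDissipation.Theorems.SawtoothPulseCascade.K1Cutoff

open Set Filter Topology Real MeasureTheory
open scoped ContDiff
open Literature.Analysis Literature.Analysis.FunctionSpaces Literature.Analysis.FunctionSpaces.Torus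
open Literature.Analysis.FluidPDE.SawtoothCascade Literature.Analysis.FluidPDE.SawtoothCascade.CascadeParams
open Summit.AnomalousDissipation.AnomalousDissipation.Theorems.SawtoothPulseCascade.K1Flat

variable (P : CascadeParams)

/-! ## Flatness on the support of a strip cut-off and of its derivative (`hflat`, `ε₁ = 2ε`) -/

/-- If the cut-off `sT((V − (1−2ε))/ε)` or its derivative is non-zero at `y` (`V ≤ 1`), then `|V(y) − 1| ≤ 2ε`. [folklore] -/
theorem abs_sub_one_le_of_cutoff_or_deriv_ne_zero {V : ℝ → ℝ} {ε : ℝ} (hε : 0 < ε) (hV1 : ∀ y, V y ≤ 1)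
    (hV : Differentiable ℝ V) {y : ℝ}
    (h : smoothTransition ((V y - (1 - 2 * ε)) / ε) ≠ 0 ∨
      deriv (fun y => smoothTransition ((V y - (1 - 2 * ε)) / ε)) y ≠ 0) : |V y - 1| ≤ 2 * ε := by
  rcases h with h | h
  · exact abs_sub_one_le_of_cutoff_ne_zero hε hV1 h
  · obtain ⟨h1, -⟩ := mem_Ioo_of_deriv_cutoff_ne_zero hε hV h
    rw [abs_sub_comm, abs_of_nonneg (by linarith [hV1 y])]
    linarith

/-- **`hflat_p` for the cascade**: where `X̃⁺ = sT((U_j′ − (1−2ε))/ε)` or `X̃⁺′` is non-zero, `|U_j′ − 1| ≤ 2ε`.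
[cite: ElgindiLissMattingly2025, §1.2.2] -/
theorem abs_deriv_U_sub_one_le_of_ne_zero {j : ℕ} (hδ : 0 < P.δ j) {ε : ℝ} (hε : 0 < ε) {y : ℝ}
    (h : smoothTransition ((deriv (P.U j) y - (1 - 2 * ε)) / ε) ≠ 0 ∨
      deriv (fun y => smoothTransition ((deriv (P.U j) y - (1 - 2 * ε)) / ε)) y ≠ 0) :
    |deriv (P.U j) y - 1| ≤ 2 * ε :=
  abs_sub_one_le_of_cutoff_or_deriv_ne_zero hε (fun y => (abs_le.mp (P.abs_deriv_U_le_one hδ y)).2)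
    ((P.contDiff_deriv_U hδ (n := ⊤)).differentiable (by simp)) h

/-- **`hflat_m` for the cascade**: where `X̃⁻ = sT((−U_j′ − (1−2ε))/ε)` or `X̃⁻′` is non-zero, `|U_j′ − (−1)| ≤ 2ε`.
[cite: ElgindiLissMattingly2025, §1.2.2] -/
theorem abs_deriv_U_sub_neg_one_le_of_ne_zero {j : ℕ} (hδ : 0 < P.δ j) {ε : ℝ} (hε : 0 < ε) {y : ℝ}
    (h : smoothTransition ((-deriv (P.U j) y - (1 - 2 * ε)) / ε) ≠ 0 ∨
      deriv (fun y => smoothTransition ((-deriv (P.U j) y - (1 - 2 * ε)) / ε)) y ≠ 0) :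
    |deriv (P.U j) y - (-1)| ≤ 2 * ε := by
  have h' : |(-deriv (P.U j) y) - 1| ≤ 2 * ε :=
    abs_sub_one_le_of_cutoff_or_deriv_ne_zero (V := fun y => -deriv (P.U j) y) hε
      (fun y => by linarith [(abs_le.mp (P.abs_deriv_U_le_one hδ y)).1])
      ((P.contDiff_deriv_U hδ (n := ⊤)).differentiable (by simp)).neg h
  rw [show deriv (P.U j) y - (-1) = -((-deriv (P.U j) y) - 1) by ring, abs_neg]
  exact h'

/-! ## `X·X̃ = X` for the cut-off at width `ε` and the wider one at width `2ε` (`hXXs`) -/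

/-- `sT((V − (1−2ε))/ε) · sT((V − (1−4ε))/(2ε)) = sT((V − (1−2ε))/ε)`: the wider cut-off is `1` on the support of the
narrower. [folklore] -/
theorem cutoff_mul_cutoff_two_mul {V : ℝ → ℝ} {ε : ℝ} (hε : 0 < ε) (y : ℝ) :
    smoothTransition ((V y - (1 - 2 * ε)) / ε) * smoothTransition ((V y - (1 - 2 * (2 * ε))) / (2 * ε)) =
      smoothTransition ((V y - (1 - 2 * ε)) / ε) := by
  by_cases h : smoothTransition ((V y - (1 - 2 * ε)) / ε) = 0
  · rw [h, zero_mul]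
  · have h1 := lt_of_cutoff_ne_zero hε h
    rw [cutoff_eq_one (ε := 2 * ε) (by positivity) (by linarith), mul_one]

/-! ## One bound sequence for both cut-off families (`hDp/hDm`) -/

/-- **Common profile data `D`** of `X⁺ = sT((U_j′ − (1−2ε))/ε)` and `X⁻ = sT((−U_j′ − (1−2ε))/ε)`: one sequence with
`D 0 = 1`, `D 1 = 2C₁(M+4)Λ_j`, `D 2 = (4C₂(M+4)² + 2C₁(2M²+33))Λ_j²` (`Λ_j = 2πN_j/δ_j`) bounding all derivatives of both.
[cite: ElgindiLissMattingly2025, §1.2.2] -/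
theorem exists_common_bound_seq_cutoff {j : ℕ} (hδj : 0 < P.δ j) {ε M C₁ C₂ : ℝ} (hε : 0 < ε) (hM : 1 ≤ M)
    (hMε : Real.exp (-(M ^ 2 / 2)) ≤ 2 * ε) (hC₁ : ∀ x, |deriv smoothTransition x| ≤ C₁)
    (hC₂ : ∀ x, |deriv (deriv smoothTransition) x| ≤ C₂) :
    ∃ D : ℕ → ℝ, D 0 = 1 ∧ D 1 = 2 * C₁ * (M + 4) * (2 * Real.pi * P.N j / P.δ j) ∧
      D 2 = (4 * C₂ * (M + 4) ^ 2 + 2 * C₁ * (2 * M ^ 2 + 33)) * (2 * Real.pi * P.N j / P.δ j) ^ 2 ∧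
      (∀ k y, |iteratedDeriv k (fun y => smoothTransition ((deriv (P.U j) y - (1 - 2 * ε)) / ε)) y| ≤ D k) ∧
      ∀ k y, |iteratedDeriv k (fun y => smoothTransition ((-deriv (P.U j) y - (1 - 2 * ε)) / ε)) y| ≤ D k := by
  obtain ⟨D, h0, h1, h2, hD⟩ := exists_bound_seq_cutoff_deriv_U P hδj hε hM hMε hC₁ hC₂
  obtain ⟨D', h0', h1', h2', hD'⟩ := exists_bound_seq_cutoff_neg_deriv_U P hδj hε hM hMε hC₁ hC₂
  exact ⟨fun k => max (D k) (D' k), by show max (D 0) (D' 0) = _; rw [h0, h0', max_self],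
    by show max (D 1) (D' 1) = _; rw [h1, h1', max_self], by show max (D 2) (D' 2) = _; rw [h2, h2', max_self],
    fun k y => (hD k y).trans (le_max_left _ _), fun k y => (hD' k y).trans (le_max_right _ _)⟩

/-! ## The residual `Q_res = −γ·(U_j − Ũ_j)`: slope and curvature in `γ`-form (twist-moment data) -/

/-- `|Q_res′| ≤ γ·(2·(3ε))` for `Q_res(y) = −γ∫₀ʸ D_{3ε}(U_j′)` (`0 ≤ γ`, `0 < ε ≤ 1/6`). [cite: ElgindiLissMattingly2025, §1.2.2] -/
theorem abs_deriv_residualShear_le (hγ : 0 ≤ P.γ) {ε : ℝ} (hε : 0 < ε) (hε6 : ε ≤ 1 / 6) {j : ℕ} (hδj : 0 < P.δ j)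
    (y : ℝ) :
    |deriv (fun y => -P.γ * ∫ t in (0 : ℝ)..y, ((1 - deriv (P.U j) t) *
        smoothTransition ((deriv (P.U j) t - (1 - 2 * (3 * ε))) / (3 * ε)) +
      (-1 - deriv (P.U j) t) * smoothTransition ((-deriv (P.U j) t - (1 - 2 * (3 * ε))) / (3 * ε)))) y| ≤
      P.γ * (2 * (3 * ε)) := by
  have h := abs_deriv_const_mul_residual_le P (-P.γ) (δ := 3 * ε) (by positivity) (by linarith) hδj y
  rwa [abs_neg, abs_of_nonneg hγ] at h

/-- `|Q_res″| ≤ γ·((2+8C₁)(M+4)Λ_j(3ε))` (`M ≥ 1`, `e^{−M²/2} ≤ 2·(3ε)`). [cite: ElgindiLissMattingly2025, §1.2.2] -/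
theorem abs_deriv_deriv_residualShear_le (hγ : 0 ≤ P.γ) {ε M C₁ : ℝ} (hε : 0 < ε) (hε6 : ε ≤ 1 / 6) (hM : 1 ≤ M)
    (hMε : Real.exp (-(M ^ 2 / 2)) ≤ 2 * (3 * ε)) (hC₁ : ∀ x, |deriv smoothTransition x| ≤ C₁) {j : ℕ}
    (hδj : 0 < P.δ j) (hN : P.N j ≠ 0) (y : ℝ) :
    |deriv (deriv fun y => -P.γ * ∫ t in (0 : ℝ)..y, ((1 - deriv (P.U j) t) *
        smoothTransition ((deriv (P.U j) t - (1 - 2 * (3 * ε))) / (3 * ε)) +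
      (-1 - deriv (P.U j) t) * smoothTransition ((-deriv (P.U j) t - (1 - 2 * (3 * ε))) / (3 * ε)))) y| ≤
      P.γ * ((2 + 8 * C₁) * (M + 4) * (2 * Real.pi * P.N j / P.δ j) * (3 * ε)) := by
  have h := abs_deriv_deriv_const_mul_residual_le P (-P.γ) (δ := 3 * ε) (by positivity) (by linarith) hM hMε hC₁
    hδj hN y
  rwa [abs_neg, abs_of_nonneg hγ] at h

/-- **Monotonicity of the twist-moment bound in `|n|`** (`hAQn` from the fibrewise bound of `…TwistMoments`).
[folklore] -/
theorem twistMomentBound_mono {ω₁ D₁ D₂ R₀ : ℝ} (hω₁ : 0 ≤ ω₁) (hD₁ : 0 ≤ D₁) (hD₂ : 0 ≤ D₂) {n : ℤ}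
    (hn : |(n : ℝ)| < R₀) :
    ω₁ * ((2 * Real.pi * |(n : ℝ)| * D₂ + (2 * Real.pi * |(n : ℝ)| * D₁) ^ 2) / (4 * Real.pi * Real.sqrt 3)) ≤
      ω₁ * ((2 * Real.pi * R₀ * D₂ + (2 * Real.pi * R₀ * D₁) ^ 2) / (4 * Real.pi * Real.sqrt 3)) := by
  have hn' : |(n : ℝ)| ≤ R₀ := hn.le
  gcongr

/-! ## The torus zone volumes of the capstone (`vol{X⁺+X⁻ ≠ 1}`, `vol{X⁺+X⁻ ∉ {0,1}}` on `𝕋^d`) -/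

variable {d : Type*} [Fintype d]

/-- **Torus zone volume versus the 1-D zone**: for profiles with `X⁺ + X⁻ ≤ 1`,
`vol{x ∈ 𝕋^d : X⁺(x_l) + X⁻(x_l) ≠ 1} ≤ vol{y ∈ (0,1] : X⁺(y) + X⁻(y) < 1}`. [folklore] -/
theorem volume_real_torus_zone_le (Xp Xm : ShearProfile) (h1 : ∀ y, Xp y + Xm y ≤ 1) (l : d) :
    volume.real {x : UnitAddTorus d | Xp.onCircle (x l) + Xm.onCircle (x l) ≠ 1} ≤
      volume.real {y : ℝ | y ∈ Ioc (0 : ℝ) 1 ∧ Xp y + Xm y < 1} := by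
  set S : Set UnitAddCircle := {b | Xp.onCircle b + Xm.onCircle b ≠ 1} with hS_def
  have hf : Measurable fun b : UnitAddCircle => Xp.onCircle b + Xm.onCircle b :=
    (Xp.continuous_onCircle.add Xm.continuous_onCircle).measurable
  have hS : MeasurableSet S := hf (measurableSet_singleton (1 : ℝ)).compl
  have hev : MeasurePreserving (fun x : UnitAddTorus d => x l) volume volume :=
    measurePreserving_eval (fun _ : d => (volume : Measure UnitAddCircle)) l
  have hA : volume {x : UnitAddTorus d | Xp.onCircle (x l) + Xm.onCircle (x l) ≠ 1} = volume S :=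
    hev.measure_preimage hS.nullMeasurableSet
  have hB : volume S = volume ((↑) ⁻¹' S ∩ Ioc (0 : ℝ) (0 + 1)) := AddCircle.add_projection_respects_measure 1 0 hS
  have hsub : ((↑) ⁻¹' S ∩ Ioc (0 : ℝ) (0 + 1) : Set ℝ) ⊆ {y : ℝ | y ∈ Ioc (0 : ℝ) 1 ∧ Xp y + Xm y < 1} := by
    rintro y ⟨hyS, hy⟩
    rw [zero_add] at hy
    refine ⟨hy, lt_of_le_of_ne (h1 y) ?_⟩
    have : Xp.onCircle (y : UnitAddCircle) + Xm.onCircle (y : UnitAddCircle) ≠ 1 := hyS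
    simpa only [ShearProfile.onCircle_coe] using this
  have hfin : volume {y : ℝ | y ∈ Ioc (0 : ℝ) 1 ∧ Xp y + Xm y < 1} ≠ ⊤ :=
    ((measure_mono (fun y hy => hy.1)).trans_lt (by rw [Real.volume_Ioc]; exact ENNReal.ofReal_lt_top)).ne
  rw [measureReal_def, measureReal_def, hA, hB]
  exact ENNReal.toReal_mono hfin (measure_mono hsub)

/-- The smaller zone `{X⁺+X⁻ ∉ {0,1}}` is bounded by the same 1-D zone. [folklore] -/
theorem volume_real_torus_zone_le' (Xp Xm : ShearProfile) (h1 : ∀ y, Xp y + Xm y ≤ 1) (l : d) :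
    volume.real {x : UnitAddTorus d | Xp.onCircle (x l) + Xm.onCircle (x l) ≠ 0 ∧ Xp.onCircle (x l) + Xm.onCircle (x l) ≠ 1}
      ≤ volume.real {y : ℝ | y ∈ Ioc (0 : ℝ) 1 ∧ Xp y + Xm y < 1} := by
  refine le_trans ?_ (volume_real_torus_zone_le Xp Xm h1 l)
  refine measureReal_mono (fun x hx => hx.2) ?_
  exact (measure_lt_top _ _).ne

/-- **The two torus zone volumes of the cascade cut-offs are `≤ 4Mδ_j/π`** (`M ≥ 1`, `Mδ_j ≤ π/2`, `2e^{−M²/2} ≤ ε ≤ ½`).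
[cite: ElgindiLissMattingly2025, §1 (corner strips)] -/
theorem volume_real_cutoff_zones_le {j : ℕ} (hδ : 0 < P.δ j) (hN : P.N j ≠ 0) {M ε : ℝ} (hM : 1 ≤ M)
    (hMδ : M * P.δ j ≤ Real.pi / 2) (hMε : 2 * Real.exp (-(M ^ 2 / 2)) ≤ ε) (hε : 0 < ε) (hε2 : ε ≤ 1 / 2)
    (Xp Xm : ShearProfile) (hXp : ∀ y, Xp y = smoothTransition ((deriv (P.U j) y - (1 - 2 * ε)) / ε))
    (hXm : ∀ y, Xm y = smoothTransition ((-deriv (P.U j) y - (1 - 2 * ε)) / ε)) (l : d) :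
    volume.real {x : UnitAddTorus d | Xp.onCircle (x l) + Xm.onCircle (x l) ≠ 1} ≤ 4 * M * P.δ j / Real.pi ∧
    volume.real {x : UnitAddTorus d | Xp.onCircle (x l) + Xm.onCircle (x l) ≠ 0 ∧ Xp.onCircle (x l) + Xm.onCircle (x l) ≠ 1}
      ≤ 4 * M * P.δ j / Real.pi := by
  have h1 : ∀ y, Xp y + Xm y ≤ 1 := fun y => by
    rw [hXp, hXm]
    rcases mul_eq_zero.mp (cutoff_mul_cutoff_neg_eq_zero (V := deriv (P.U j)) hε hε2 y) with h | h
    · rw [h, zero_add]; exact cutoff_le_one _ _ _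
    · rw [h, add_zero]; exact cutoff_le_one _ _ _
  have hzone : ∀ y, Xp y + Xm y < 1 → |deriv (P.U j) y| < 1 - ε := by
    intro y hy
    rw [hXp, hXm] at hy
    have hp : smoothTransition ((deriv (P.U j) y - (1 - 2 * ε)) / ε) < 1 := by
      linarith [cutoff_nonneg (fun y => -deriv (P.U j) y) ε y]
    have hm : smoothTransition ((-deriv (P.U j) y - (1 - 2 * ε)) / ε) < 1 := by
      linarith [cutoff_nonneg (deriv (P.U j)) ε y]
    have hp' : deriv (P.U j) y < 1 - ε := by
      by_contra hc
      exact hp.ne (cutoff_eq_one hε (not_lt.mp hc))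
    have hm' : -deriv (P.U j) y < 1 - ε := by
      by_contra hc
      exact hm.ne (cutoff_eq_one (V := fun y => -deriv (P.U j) y) hε (not_lt.mp hc))
    exact abs_lt.mpr ⟨by linarith, hp'⟩
  have hz := measureReal_cutoff_zone_le P hδ hN hM hMδ hMε Xp Xm hzone
  exact ⟨(volume_real_torus_zone_le Xp Xm h1 l).trans hz, (volume_real_torus_zone_le' Xp Xm h1 l).trans hz⟩

end Summit.AnomalousDissipation.AnomalousDissipation.Theorems.SawtoothPulseCascade.K1Cutoff
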